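import Summits.AnomalousDissipation.AnomalousDissipation.Theorems.SawtoothPulseCascadeK1LocalisedCascadeKHTransportParseval

/-!
# K2 lane (route-2 `SawtoothPulseCascade`, crux dir `K1LocalisedCascade`): Bloch polynomials on one period — orthogonality, coefficient extraction, `L²` norm, derivative, and Parseval for bounded measurable interiors (tools for the transport-duality bound, E6 sub-lemma L-i-b, A27-7)

Helper file of the K2 lane (ACL item stmt-AnomalousDissipation-19491). A row (or column) profile of p4's lattice states is a BLOCH POLYNOMIAL
`ψ(x) = Σ_{m∈S} a(m) e^{2πi(α+m)x}` (`K2ConeSketch.modeProfile`: class offset `α`, finitely many modes), and p4's transverse coefficient is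
`ĝ(k) = ∫_{−½}^{½} g(x) e^{−2πi(α+k)x} dx` (`coeff`). This file collects the elementary facts the energy-form transport bound (`…KHTransportDuality`) is
assembled from: orthogonality of the Bloch exponentials on `[−½,½]` (`integral_blochExp_mul_conjExp`), coefficient extraction
(`integral_blochPoly_mul_conjExp`), `∫_{−½}^{½}‖ψ‖² = Σ_{m∈S}‖a(m)‖²` (`integral_norm_sq_blochPoly`), the derivative `ψ′ = Σ 2πi(α+m)a(m)e^{2πi(α+m)x}`
(`hasDerivAt_blochPoly`), the pairing `∫ g·conj(ψ) = Σ_{m∈S} conj(a m)·ĝ(m)`-type identities (`integral_mul_conj_blochPoly`,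
`integral_blochPoly_mul_conj`), and Parseval `Σ_k ‖ĝ(k)‖² = ∫‖g‖²` for a BOUNDED (a.e.-strongly-)MEASURABLE interior (`hasSum_sq_coeff_of_bound`,
extending the continuous case `hasSum_sq_coeff` of `…KHTransportParseval` to the piecewise-continuous derivatives that appear after a sawtooth shear).
No definitions; nothing about the crux by name. [folklore] [problem: turb]
-/

-- `Summit.<Summit>.<Problem>`: single-conjunct summit, the duplicate namespace segment is deliberate.
set_option linter.dupNamespace false

noncomputable section

namespace Summit.AnomalousDissipation.AnomalousDissipation.Theorems.SawtoothPulseCascade.K2PhaseBudget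

open Finset MeasureTheory intervalIntegral Set

/-- `∫_{−½}^{½} e^{2πikx} dx = [k = 0]` for an integer `k`. [folklore] -/
theorem integral_cexp_two_pi_int_mul (k : ℤ) :
    ∫ x in (-(1 / 2 : ℝ))..(1 / 2), Complex.exp (((2 * Real.pi * k * x : ℝ) : ℂ) * Complex.I) = if k = 0 then 1 else 0 := by
  split_ifs with hk
  · subst hk; simp; norm_num
  · have hc : (((2 * Real.pi * k : ℝ) : ℂ) * Complex.I) ≠ 0 := by
      apply mul_ne_zero _ Complex.I_ne_zero
      exact_mod_cast (mul_ne_zero (mul_ne_zero two_ne_zero Real.pi_ne_zero) (Int.cast_ne_zero.2 hk))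
    have e : ∀ x : ℝ, Complex.exp (((2 * Real.pi * k * x : ℝ) : ℂ) * Complex.I) = Complex.exp ((((2 * Real.pi * k : ℝ) : ℂ) * Complex.I) * x) := by
      intro x; congr 1; push_cast; ring
    simp_rw [e]
    rw [integral_exp_mul_complex hc]
    have h1 : Complex.exp ((((2 * Real.pi * k : ℝ) : ℂ) * Complex.I) * (1 / 2 : ℝ)) = Complex.exp ((Real.pi * k : ℝ) * Complex.I) := by
      congr 1; push_cast; ring
    have h2 : Complex.exp ((((2 * Real.pi * k : ℝ) : ℂ) * Complex.I) * (-(1 / 2) : ℝ)) = Complex.exp ((Real.pi * k : ℝ) * Complex.I) := by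
      rw [show (((2 * Real.pi * k : ℝ) : ℂ) * Complex.I) * ((-(1 / 2) : ℝ) : ℂ) = (Real.pi * k : ℝ) * Complex.I - (k : ℂ) * (2 * Real.pi * Complex.I) by
        push_cast; ring, Complex.exp_sub, Complex.exp_int_mul_two_pi_mul_I, div_one]
    rw [h1, h2, sub_self, zero_div]

/-- **Orthogonality of the Bloch exponentials on one period:** `∫_{−½}^{½} e^{2πi(α+m)x} e^{−2πi(α+k)x} dx = [m = k]`. [folklore] -/
theorem integral_blochExp_mul_conjExp (α : ℝ) (m k : ℤ) :
    ∫ x in (-(1 / 2 : ℝ))..(1 / 2), Complex.exp ((2 * Real.pi * (α + m) * x : ℝ) * Complex.I) *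
        Complex.exp (-(2 * Real.pi * (α + k) * x : ℝ) * Complex.I) = if m = k then 1 else 0 := by
  have e : ∀ x : ℝ, Complex.exp ((2 * Real.pi * (α + m) * x : ℝ) * Complex.I) * Complex.exp (-(2 * Real.pi * (α + k) * x : ℝ) * Complex.I) =
      Complex.exp (((2 * Real.pi * ((m - k : ℤ)) * x : ℝ) : ℂ) * Complex.I) := by
    intro x; rw [← Complex.exp_add]; congr 1; push_cast; ring
  simp_rw [e, integral_cexp_two_pi_int_mul, sub_eq_zero]

/-- The conjugate of a Bloch exponential. [folklore] -/
theorem conj_blochExp (α : ℝ) (k : ℤ) (x : ℝ) :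
    (starRingEnd ℂ) (Complex.exp ((2 * Real.pi * (α + k) * x : ℝ) * Complex.I)) = Complex.exp (-(2 * Real.pi * (α + k) * x : ℝ) * Complex.I) := by
  rw [← Complex.exp_conj, map_mul, Complex.conj_ofReal, Complex.conj_I]
  congr 1
  ring

/-- A Bloch polynomial is continuous. [folklore] -/
theorem continuous_blochPoly (α : ℝ) (S : Finset ℤ) (a : ℤ → ℂ) :
    Continuous fun x : ℝ => ∑ m ∈ S, a m * Complex.exp ((2 * Real.pi * (α + m) * x : ℝ) * Complex.I) := by
  fun_prop

/-- **Coefficient extraction:** `∫_{−½}^{½} ψ(x) e^{−2πi(α+k)x} dx = a(k)·[k ∈ S]` for `ψ = Σ_{m∈S} a(m)e^{2πi(α+m)x}`. [folklore] -/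
theorem integral_blochPoly_mul_conjExp (α : ℝ) (S : Finset ℤ) (a : ℤ → ℂ) (k : ℤ) :
    ∫ x in (-(1 / 2 : ℝ))..(1 / 2), (∑ m ∈ S, a m * Complex.exp ((2 * Real.pi * (α + m) * x : ℝ) * Complex.I)) *
        Complex.exp (-(2 * Real.pi * (α + k) * x : ℝ) * Complex.I) = if k ∈ S then a k else 0 := by
  have e : ∀ m : ℤ, ∀ x : ℝ, a m * Complex.exp ((2 * Real.pi * (α + m) * x : ℝ) * Complex.I) * Complex.exp (-(2 * Real.pi * (α + k) * x : ℝ) * Complex.I) =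
      a m * Complex.exp (((2 * Real.pi * ((m - k : ℤ)) * x : ℝ) : ℂ) * Complex.I) := by
    intro m x; rw [mul_assoc, ← Complex.exp_add]; congr 2; push_cast; ring
  simp_rw [Finset.sum_mul, e]
  rw [intervalIntegral.integral_finsetSum (fun m _ => (by fun_prop : Continuous fun x : ℝ =>
    a m * Complex.exp (((2 * Real.pi * ((m - k : ℤ)) * x : ℝ) : ℂ) * Complex.I)).intervalIntegrable _ _)]
  simp_rw [intervalIntegral.integral_const_mul, integral_cexp_two_pi_int_mul, sub_eq_zero, mul_ite, mul_one, mul_zero]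
  rw [Finset.sum_ite_eq' S k a]

/-- The conjugate of a conjugate Bloch exponential. [folklore] -/
theorem conj_conjBlochExp (α : ℝ) (k : ℤ) (x : ℝ) :
    (starRingEnd ℂ) (Complex.exp (-(2 * Real.pi * (α + k) * x : ℝ) * Complex.I)) = Complex.exp ((2 * Real.pi * (α + k) * x : ℝ) * Complex.I) := by
  rw [← Complex.exp_conj, map_mul, map_neg, Complex.conj_ofReal, Complex.conj_I]
  congr 1
  ring

/-- **Pairing with a Bloch polynomial:** `∫_{−½}^{½} g·conj(ψ) = Σ_{k∈S} conj(a k)·ĝ(k)` for a continuous `g`. [folklore] -/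
theorem integral_mul_conj_blochPoly {g : ℝ → ℂ} (hg : Continuous g) (α : ℝ) (S : Finset ℤ) (a : ℤ → ℂ) :
    ∫ x in (-(1 / 2 : ℝ))..(1 / 2), g x * (starRingEnd ℂ) (∑ m ∈ S, a m * Complex.exp ((2 * Real.pi * (α + m) * x : ℝ) * Complex.I)) =
      ∑ k ∈ S, (starRingEnd ℂ) (a k) * ∫ x in (-(1 / 2 : ℝ))..(1 / 2), g x * Complex.exp (-(2 * Real.pi * (α + k) * x : ℝ) * Complex.I) := by
  simp_rw [map_sum, map_mul, conj_blochExp, Finset.mul_sum]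
  rw [intervalIntegral.integral_finsetSum (fun m _ => (by fun_prop : Continuous fun x : ℝ =>
    g x * ((starRingEnd ℂ) (a m) * Complex.exp (-(2 * Real.pi * (α + m) * x : ℝ) * Complex.I))).intervalIntegrable _ _)]
  refine Finset.sum_congr rfl fun k _ => ?_
  rw [← intervalIntegral.integral_const_mul]
  refine intervalIntegral.integral_congr fun x _ => ?_
  ring

/-- **Pairing of a Bloch polynomial with a test function:** `∫_{−½}^{½} ψ·conj(f) = Σ_{m∈S} a(m)·conj(f̂(m))` for a continuous `f`. [folklore] -/
theorem integral_blochPoly_mul_conj {f : ℝ → ℂ} (hf : Continuous f) (α : ℝ) (S : Finset ℤ) (a : ℤ → ℂ) :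
    ∫ x in (-(1 / 2 : ℝ))..(1 / 2), (∑ m ∈ S, a m * Complex.exp ((2 * Real.pi * (α + m) * x : ℝ) * Complex.I)) * (starRingEnd ℂ) (f x) =
      ∑ m ∈ S, a m * (starRingEnd ℂ) (∫ x in (-(1 / 2 : ℝ))..(1 / 2), f x * Complex.exp (-(2 * Real.pi * (α + m) * x : ℝ) * Complex.I)) := by
  simp_rw [Finset.sum_mul]
  rw [intervalIntegral.integral_finsetSum (fun m _ => (by fun_prop : Continuous fun x : ℝ =>
    a m * Complex.exp ((2 * Real.pi * (α + m) * x : ℝ) * Complex.I) * (starRingEnd ℂ) (f x)).intervalIntegrable _ _)]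
  refine Finset.sum_congr rfl fun m _ => ?_
  have hc : ∫ x in (-(1 / 2 : ℝ))..(1 / 2), (starRingEnd ℂ) (f x * Complex.exp (-(2 * Real.pi * (α + m) * x : ℝ) * Complex.I)) =
      (starRingEnd ℂ) (∫ x in (-(1 / 2 : ℝ))..(1 / 2), f x * Complex.exp (-(2 * Real.pi * (α + m) * x : ℝ) * Complex.I)) :=
    (Complex.conjLIE.toContinuousLinearMap.intervalIntegral_comp_comm ((by fun_prop : Continuous fun x : ℝ =>
      f x * Complex.exp (-(2 * Real.pi * (α + m) * x : ℝ) * Complex.I)).intervalIntegrable _ _))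
  rw [← hc, ← intervalIntegral.integral_const_mul]
  refine intervalIntegral.integral_congr fun x _ => ?_
  simp only [map_mul, conj_conjBlochExp]
  ring

/-- **`L²` norm of a Bloch polynomial on one period:** `∫_{−½}^{½} ‖ψ‖² = Σ_{m∈S} ‖a(m)‖²`. [folklore] -/
theorem integral_norm_sq_blochPoly (α : ℝ) (S : Finset ℤ) (a : ℤ → ℂ) :
    ∫ x in (-(1 / 2 : ℝ))..(1 / 2), ‖∑ m ∈ S, a m * Complex.exp ((2 * Real.pi * (α + m) * x : ℝ) * Complex.I)‖ ^ 2 = ∑ m ∈ S, ‖a m‖ ^ 2 := by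
  have h := hasSum_sq_coeff (continuous_blochPoly α S a) α
  simp_rw [integral_blochPoly_mul_conjExp] at h
  have h2 : HasSum (fun n : ℤ => ‖(if n ∈ S then a n else 0 : ℂ)‖ ^ 2) (∑ m ∈ S, ‖a m‖ ^ 2) := by
    have h3 : ∑ m ∈ S, ‖a m‖ ^ 2 = ∑ n ∈ S, ‖(if n ∈ S then a n else 0 : ℂ)‖ ^ 2 :=
      Finset.sum_congr rfl fun n hn => by rw [if_pos hn]
    rw [h3]
    exact hasSum_sum_of_ne_finset_zero fun n hn => by simp [hn]
  exact h.unique h2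

/-- **Derivative of a Bloch polynomial.** [folklore] -/
theorem hasDerivAt_blochPoly (α : ℝ) (S : Finset ℤ) (a : ℤ → ℂ) (x : ℝ) :
    HasDerivAt (fun x : ℝ => ∑ m ∈ S, a m * Complex.exp ((2 * Real.pi * (α + m) * x : ℝ) * Complex.I))
      (∑ m ∈ S, a m * (Complex.exp ((2 * Real.pi * (α + m) * x : ℝ) * Complex.I) * (((2 * Real.pi * (α + m) : ℝ) : ℂ) * Complex.I))) x := by
  have h : ∀ m ∈ S, HasDerivAt (fun x : ℝ => a m * Complex.exp ((2 * Real.pi * (α + m) * x : ℝ) * Complex.I))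
      (a m * (Complex.exp ((2 * Real.pi * (α + m) * x : ℝ) * Complex.I) * (((2 * Real.pi * (α + m) : ℝ) : ℂ) * Complex.I))) x := by
    intro m _
    have h0 : HasDerivAt (fun x : ℝ => 2 * Real.pi * (α + m) * x) (2 * Real.pi * (α + m)) x := by
      simpa using (hasDerivAt_id x).const_mul (2 * Real.pi * (α + m))
    have h1 : HasDerivAt (fun x : ℝ => ((2 * Real.pi * (α + m) * x : ℝ) : ℂ) * Complex.I) (((2 * Real.pi * (α + m) : ℝ) : ℂ) * Complex.I) x :=
      h0.ofReal_comp.mul_const Complex.I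
    have h2 : HasDerivAt (fun x : ℝ => Complex.exp (((2 * Real.pi * (α + m) * x : ℝ) : ℂ) * Complex.I))
        (Complex.exp (((2 * Real.pi * (α + m) * x : ℝ) : ℂ) * Complex.I) * (((2 * Real.pi * (α + m) : ℝ) : ℂ) * Complex.I)) x := h1.cexp
    exact h2.const_mul (a m)
  have hs := HasDerivAt.sum h
  simpa only [Finset.sum_fn] using hs

/-- **Parseval for a bounded, a.e.-strongly-measurable interior** (extends `hasSum_sq_coeff`): `Σ_k ‖ĝ(k)‖² = ∫_{−½}^{½}‖g‖²`. [folklore] -/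
theorem hasSum_sq_coeff_of_bound {g : ℝ → ℂ} (hgm : AEStronglyMeasurable g (volume.restrict (Ioc (-(1 / 2 : ℝ)) (1 / 2)))) {C : ℝ}
    (hC : ∀ y, ‖g y‖ ≤ C) (β : ℝ) :
    HasSum (fun n : ℤ => ‖∫ y in (-(1 / 2 : ℝ))..(1 / 2), g y * Complex.exp (-(2 * Real.pi * (β + n) * y : ℝ) * Complex.I)‖ ^ 2)
      (∫ y in (-(1 / 2 : ℝ))..(1 / 2), ‖g y‖ ^ 2) := by
  have hab : (-(1 / 2 : ℝ)) < 1 / 2 := by norm_num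
  set f : ℝ → ℂ := fun y => g y * Complex.exp (-((2 * Real.pi * β * y : ℝ) : ℂ) * Complex.I) with hf
  have hn1 : ∀ y : ℝ, ‖f y‖ = ‖g y‖ := by
    intro y
    rw [hf]
    simp only
    rw [norm_mul, show -((2 * Real.pi * β * y : ℝ) : ℂ) * Complex.I = ((-(2 * Real.pi * β * y) : ℝ) : ℂ) * Complex.I by push_cast; ring,
      Complex.norm_exp_ofReal_mul_I, mul_one]
  have hfm : AEStronglyMeasurable f (volume.restrict (Ioc (-(1 / 2 : ℝ)) (1 / 2))) :=
    hgm.mul (by fun_prop : Continuous fun y : ℝ => Complex.exp (-((2 * Real.pi * β * y : ℝ) : ℂ) * Complex.I)).aestronglyMeasurable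
  have hL2 : MemLp f 2 (volume.restrict (Ioc (-(1 / 2 : ℝ)) (1 / 2))) :=
    MemLp.of_bound hfm C (Filter.Eventually.of_forall fun y => (hn1 y).le.trans (hC y))
  have h := hasSum_sq_fourierCoeffOn hab hL2
  simp_rw [hf, fourierCoeffOn_eq_coeff] at h
  have hT : ((1 / 2 : ℝ) - -(1 / 2))⁻¹ = 1 := by norm_num
  rw [hT, one_smul] at h
  have hn : ∀ y : ℝ, ‖g y * Complex.exp (-((2 * Real.pi * β * y : ℝ) : ℂ) * Complex.I)‖ ^ 2 = ‖g y‖ ^ 2 := fun y => by rw [← hn1 y]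
  simp_rw [hn] at h
  exact h

end Summit.AnomalousDissipation.AnomalousDissipation.Theorems.SawtoothPulseCascade.K2PhaseBudget
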